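import Summits.BirchSwinnertonDyer.BirchSwinnertonDyer.Theorems.GenusKolyvaginAtTwoMinimalTwinBSDTwoOddCutOfTranspositionWitness
import Summits.BirchSwinnertonDyer.BirchSwinnertonDyer.Theorems.GenusKolyvaginAtTwoMinimalTwinBSDTwoSwappedPairSandwich
import HarnessLib

/-!
# Route `GenusKolyvaginAtTwo`, crux U₂ `MinimalTwinBSDTwo` (stmt-BirchSwinnertonDyer-22985), LINE 23 «twin_swap» — A NEGATIVE BOOKKEEPING LEMMA:
# AT A DOOR-OPEN BUDGET FRAME (`#Sel₂(Wd) = 1`) OF POSITIVE DEPTH THERE IS NO DEEP WITNESS, so LINE 23's Kolyvagin leaf must quantify over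
# DOOR-CLOSED frames only (door-open frames are decided by the depth-zero bit)

Seat `bsd-line-gk2-p2` g32 (PROVER seat 2/3, cell `bsd-f1-sign2`, LINE 23 holder), `--supports stmt-BirchSwinnertonDyer-22985 --as helper`.
THEOREMS ONLY (no definition, no named fact, no `sorry`).  BSD is NOT proved by any of this; U₂ is NOT proved; nothing is closed.

WHY.  gk2-p2 g23's sandwich `TwinSwap.finite_and_natCard_primaryComponent_sha_baseChange_two_eq_one_of_swappedPair` says: `W` rank `≥ 1` with
`#Sel₂(W) = 2`, a twin model `Wd ≅ W^{(d_K)}` inside the genus budget with `#Sel₂(Wd) = 1` (DOOR OPEN) ⟹ `#Ш(W_K)[2^∞] = 1` — unconditionally.  This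
seat's lower half (p811686 `pow_dvd_natCard_sha_baseChange_of_transpositionWitness_signFree`) says a transposition-deep witness forces
`4^{M₀} ∣ #Ш(W_K)[2^∞]`.  Hence at a door-open budget frame whose `P(1)` has exact depth `M₀ ≥ 1` NO transposition-deep witness exists (mod Q2): the
v2.8 stub WITNESS^±_{≥1}, which asks for a witness at EVERY frame of depth `≥ 1`, would be FALSE there — such frames are BSD-inconsistent (BSD₂(W)
predicts `M₀ = 0` at door-open frames: KEX′ exactness reads `1 = 4^{M₀}`), so the Kolyvagin leaf of LINE 23 must be restricted to DOOR-CLOSED frames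
(v2.9: WITNESS^±_{dc,≥2}), and door-open frames enter only through the depth-zero bit `y_K ∉ 2W(K)` (FRAME side).
* §1 `not_transpositionWitness_of_doorOpen_of_one_le_depth` — the negative lemma (mod Q2).
* §2 `depth_eq_zero_of_doorOpen_of_transpositionWitness` — contrapositive packaging: a witness at a door-open budget frame forces `M₀ = 0`.

References: [Kolyvagin1989Izv] Thm. B_l; [Kolyvagin1991MathAnn] Thm. 1; [MazurRubin2010] Cor. 3.4 (i); [Kramer1981] Thm. 1.
-/

set_option autoImplicit false
set_option linter.dupNamespace false -- `Summit.<P>.<Sub>` repeats `BirchSwinnertonDyer` (D-0017)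

noncomputable section

open scoped Classical

namespace Summit.BirchSwinnertonDyer.BirchSwinnertonDyer.Theorems.GenusExact.TwinSwap.TwinAnnihilation

open Literature.NumberTheory.EllipticCurves Literature.NumberTheory.GaloisRepresentations WeierstrassCurve NumberField
  IsDedekindDomain Field AddSubgroup Literature.NumberTheory.EllipticCurves.ModularForms
open Summit.BirchSwinnertonDyer.Rank1Residual
open Summit.BirchSwinnertonDyer.BirchSwinnertonDyer.Theses.GenusKolyvaginAtTwo (KolyvaginRelationAtTwo)
open Summit.BirchSwinnertonDyer.BirchSwinnertonDyer.Theorems.GenusExact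

/-! ## §1 No deep witness at a door-open frame of positive depth -/

/-- **At a DOOR-OPEN budget frame of positive depth there is no transposition-deep witness** (mod Q2): `W/ℚ` on the habitat (globally minimal, non-CM,
`C(W)` odd, an odd multiplicative prime, `ρ_{W,2^n}` onto), `w(W) = −1`, `#Sel₂(W) = 2`; `K` odd `d_K ≠ −3` Heegner; `(Dt, β, ι, d₁)` with `P(1)` of
infinite order and exact depth `M₀ ≥ 1`; an elliptic twin model `Wd = Cd • W^{(d_K)}` inside the genus budget with `#Sel₂(Wd) = 1`.  Then NO square-free
`n₀` of transposition-deep Kolyvagin primes has `P(n₀) ∉ 2W(K[n₀])`: such a witness would give `4^{M₀} ∣ #Ш(W_K)[2^∞]` (p811686), while g23's sandwich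
gives `#Ш(W_K)[2^∞] = 1` at a door-open frame.  CONDITIONAL on Q2; BSD is NOT proved (BSD predicts that such frames have `M₀ = 0`).
[cite: Kolyvagin1991MathAnn, Thm. 1] [cite: MazurRubin2010, Cor. 3.4 (i)] [cite: Kramer1981, Thm. 1] -/
theorem not_transpositionWitness_of_doorOpen_of_one_le_depth (hQ2 : KolyvaginRelationAtTwo)
    (W : WeierstrassCurve ℚ) [W.IsElliptic] [W.IsGloballyMinimal] [NeZero (W.conductorNorm ℤ)] (hcm : ¬ W.HasCM)
    (hT : Odd W.tamagawaProduct) (v : HeightOneSpectrum (𝓞 ℚ)) (h2v : ((2 : ℕ) : 𝓞 ℚ) ∉ v.asIdeal)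
    (hNv : ((W.conductorNorm ℤ : ℕ) : 𝓞 ℚ) ∈ v.asIdeal) (hmult : W.HasMultiplicativeReductionAt v)
    (K : Type) [Field K] [NumberField K] (hIQ : IsImaginaryQuadratic K) (hodd : Odd (NumberField.discr K))
    (h3 : NumberField.discr K ≠ -3) (hHe : SatisfiesHeegnerHypothesis (W.conductorNorm ℤ) K)
    (hρ : ∀ n : ℕ, 0 < n → W.HasSurjectiveModNGaloisRep ((2 : ℤ) ^ n))
    (Dt : ModularParametrizationData W (W.conductorNorm ℤ)) (β : ℤ) (ι : K →+* ℂ) (d₁ : KolyvaginHeegnerData Dt β ι 1)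
    (hy : ¬ IsOfFinAddOrder d₁.derivedPoint) (M₀ : ℕ) (hM₀ : 1 ≤ M₀)
    (hdiv : ∃ Q : (W.baseChange (ringClassField K ι 1)).toAffine.Point, ((2 ^ M₀ : ℕ) : ℤ) • Q = d₁.derivedPoint)
    (hndiv : ¬ ∃ Q : (W.baseChange (ringClassField K ι 1)).toAffine.Point, ((2 ^ (M₀ + 1) : ℕ) : ℤ) • Q = d₁.derivedPoint)
    (hw : W.rootNumber = -1) (hSel : Nat.card (W.selmerGroup 2) = 2)
    {Wd : WeierstrassCurve ℚ} [Wd.IsElliptic] (Cd : VariableChange ℚ) (hWd : Cd • W.quadraticTwist (NumberField.discr K : ℚ) = Wd)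
    (hSel1 : Nat.card (Wd.selmerGroup 2) = 1)
    (hbudget : (W.Δ < 0 ∧ padicValNat 2 Wd.tamagawaProduct ≤ 1) ∨ padicValNat 2 Wd.tamagawaProduct = 0)
    (n₀ : ℕ) (e₀ : KolyvaginHeegnerData Dt β ι n₀) (hn₀ : Squarefree n₀)
    (hKoly : ∀ ℓ ∈ n₀.primeFactors, Zhang2014.IsKolyvaginPrime (W.conductorNorm ℤ) W K 2 ℓ ∧ 2 ≤ Zhang2014.kolyvaginIndex W 2 ℓ ∧
      ∃ (v : HeightOneSpectrum (𝓞 ℚ)) (𝔓 : Ideal (absIntegers (𝓞 ℚ) ℚ)) (h : absoluteGaloisGroup ℚ),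
        ((ℓ : ℕ) : 𝓞 ℚ) ∈ v.asIdeal ∧ 𝔓 ∈ v.primesAbove ∧ IsArithFrobAt (𝓞 ℚ) h 𝔓 ∧ ∃ u : W.geomTorsion ((2 : ℕ) : ℤ), h • u ≠ u) :
    ∃ Q : (W.baseChange (ringClassField K ι n₀)).toAffine.Point, (2 : ℤ) • Q = e₀.derivedPoint := by
  by_contra he₀
  obtain ⟨hsq1, hsq2⟩ := kolyvaginExclusions_of_odd_of_satisfiesHeegnerHypothesis W hIQ hodd hHe
  -- the lower half from the witness
  have hlow := pow_dvd_natCard_sha_baseChange_of_transpositionWitness_signFree hQ2 W hcm hT v h2v hNv hmult K hIQ hodd h3 hHe hρ Dt β ι d₁ hy M₀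
    hdiv hndiv hw hSel n₀ e₀ hn₀ hKoly he₀
  -- the door-open sandwich: `#Ш(W_K)[2^∞] = 1`
  have h2 : Module.finrank ℚ K = 2 := hIQ.1
  have hs2 : W.HasSurjectiveModNGaloisRep 2 := by simpa using hρ 1 one_pos
  have h2K : ∀ P : (W.baseChange K).toAffine.Point, (2 : ℤ) • P = 0 → P = 0 := fun P hP ↦
    EigenClassesFinite.forall_zsmul_two_pow_baseChange_eq_zero_of_hasSurjectiveModNGaloisRep_two W K h2 hs2 1 P (by simpa using hP)
  have hrk : 1 ≤ W.mordellWeilRank :=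
    one_le_mordellWeilRank_of_derivedPoint_signFree hQ2 W hcm hT v h2v hNv hmult K hIQ hodd h3 hHe hsq1 hsq2 hρ Dt β ι d₁ hy M₀ hndiv hw
  obtain ⟨-, hone⟩ := finite_and_natCard_primaryComponent_sha_baseChange_two_eq_one_of_swappedPair W K hT hIQ hodd hHe h2K hrk hSel Cd hWd
    hSel1 hbudget
  rw [hone] at hlow
  have hle : 2 ^ (2 * M₀) ≤ 1 := Nat.le_of_dvd one_pos hlow
  have hge : 4 ≤ 2 ^ (2 * M₀) := by
    calc (4 : ℕ) = 2 ^ 2 := by norm_num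
      _ ≤ 2 ^ (2 * M₀) := Nat.pow_le_pow_right (by norm_num) (by omega)
  omega

/-! ## §2 Contrapositive: a witness at a door-open frame forces depth zero -/

/-- **A transposition-deep witness at a DOOR-OPEN budget frame forces `M₀ = 0`** (same frame as §1, `M₀` any exact depth): the depth-zero bit
`y_K ∉ 2W(K)` is then automatic.  So on door-open frames U₂'s content is EXACTLY that bit; deep witnesses add nothing there.  CONDITIONAL on Q2; BSD
is NOT proved. [cite: Kolyvagin1991MathAnn, Thm. 1] [cite: MazurRubin2010, Cor. 3.4 (i)] -/
theorem depth_eq_zero_of_doorOpen_of_transpositionWitness (hQ2 : KolyvaginRelationAtTwo)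
    (W : WeierstrassCurve ℚ) [W.IsElliptic] [W.IsGloballyMinimal] [NeZero (W.conductorNorm ℤ)] (hcm : ¬ W.HasCM)
    (hT : Odd W.tamagawaProduct) (v : HeightOneSpectrum (𝓞 ℚ)) (h2v : ((2 : ℕ) : 𝓞 ℚ) ∉ v.asIdeal)
    (hNv : ((W.conductorNorm ℤ : ℕ) : 𝓞 ℚ) ∈ v.asIdeal) (hmult : W.HasMultiplicativeReductionAt v)
    (K : Type) [Field K] [NumberField K] (hIQ : IsImaginaryQuadratic K) (hodd : Odd (NumberField.discr K))
    (h3 : NumberField.discr K ≠ -3) (hHe : SatisfiesHeegnerHypothesis (W.conductorNorm ℤ) K)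
    (hρ : ∀ n : ℕ, 0 < n → W.HasSurjectiveModNGaloisRep ((2 : ℤ) ^ n))
    (Dt : ModularParametrizationData W (W.conductorNorm ℤ)) (β : ℤ) (ι : K →+* ℂ) (d₁ : KolyvaginHeegnerData Dt β ι 1)
    (hy : ¬ IsOfFinAddOrder d₁.derivedPoint) (M₀ : ℕ)
    (hdiv : ∃ Q : (W.baseChange (ringClassField K ι 1)).toAffine.Point, ((2 ^ M₀ : ℕ) : ℤ) • Q = d₁.derivedPoint)
    (hndiv : ¬ ∃ Q : (W.baseChange (ringClassField K ι 1)).toAffine.Point, ((2 ^ (M₀ + 1) : ℕ) : ℤ) • Q = d₁.derivedPoint)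
    (hw : W.rootNumber = -1) (hSel : Nat.card (W.selmerGroup 2) = 2)
    {Wd : WeierstrassCurve ℚ} [Wd.IsElliptic] (Cd : VariableChange ℚ) (hWd : Cd • W.quadraticTwist (NumberField.discr K : ℚ) = Wd)
    (hSel1 : Nat.card (Wd.selmerGroup 2) = 1)
    (hbudget : (W.Δ < 0 ∧ padicValNat 2 Wd.tamagawaProduct ≤ 1) ∨ padicValNat 2 Wd.tamagawaProduct = 0)
    (n₀ : ℕ) (e₀ : KolyvaginHeegnerData Dt β ι n₀) (hn₀ : Squarefree n₀)
    (hKoly : ∀ ℓ ∈ n₀.primeFactors, Zhang2014.IsKolyvaginPrime (W.conductorNorm ℤ) W K 2 ℓ ∧ 2 ≤ Zhang2014.kolyvaginIndex W 2 ℓ ∧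
      ∃ (v : HeightOneSpectrum (𝓞 ℚ)) (𝔓 : Ideal (absIntegers (𝓞 ℚ) ℚ)) (h : absoluteGaloisGroup ℚ),
        ((ℓ : ℕ) : 𝓞 ℚ) ∈ v.asIdeal ∧ 𝔓 ∈ v.primesAbove ∧ IsArithFrobAt (𝓞 ℚ) h 𝔓 ∧ ∃ u : W.geomTorsion ((2 : ℕ) : ℤ), h • u ≠ u)
    (he₀ : ¬ ∃ Q : (W.baseChange (ringClassField K ι n₀)).toAffine.Point, (2 : ℤ) • Q = e₀.derivedPoint) : M₀ = 0 := by
  by_contra hM₀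
  exact he₀ (not_transpositionWitness_of_doorOpen_of_one_le_depth hQ2 W hcm hT v h2v hNv hmult K hIQ hodd h3 hHe hρ Dt β ι d₁ hy M₀
    (Nat.one_le_iff_ne_zero.mpr hM₀) hdiv hndiv hw hSel Cd hWd hSel1 hbudget n₀ e₀ hn₀ hKoly)

end Summit.BirchSwinnertonDyer.BirchSwinnertonDyer.Theorems.GenusExact.TwinSwap.TwinAnnihilation

end
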